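import Summits.ResolutionOfSingularities.ResolutionOfSingularities.Theorems.FrobeniusClosingPatchingRelPerfectMonomialRouteKChartAlgebra
import Summits.ResolutionOfSingularities.ResolutionOfSingularities.Theorems.FrobeniusClosingPatchingRelPerfectMonomialPolyhedraGameMarked
import Summits.ResolutionOfSingularities.ResolutionOfSingularities.Theorems.FrobeniusClosingPatchingRelPerfectMonomialRouteKScalings
import Literature.AlgebraicGeometry.Resolution.SubschemeRegularStalks
import Literature.AlgebraicGeometry.Resolution.MarkedIdealsLemmas
import Literature.AlgebraicGeometry.Resolution.RegularLocalRingsProofs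
import HarnessLib

/-!
# Crux `PatchingRelPerfect` (stmt-ResolutionOfSingularities-16161), chain w52 — TargetsF3 (m)
# «M2-strong», COMBINATORIAL HALF, Route K step K8: TORIC CHARTS as affine opens with section
# isomorphisms onto the polynomial ring, and the point ↔ prime dictionary

[OURS · L1 W5.2 · design memo v3 (`L/res-type-075/M2STRONG-COMBINATORIAL-HALF.md`); fact-free;
nothing here is a statement of the manuscript under review]

A CHART of a level `Y` of Route K's blow-up tower over the toric model `𝔸^{B₀}_ℚ` is an affine open
`U ⊆ Y` with a ring isomorphism `e : Γ(Y, U) ≅ ℚ[x_b : b ∈ B₀]` and a labelling `lab` of the variables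
by game indices (`Chart`).  Everything the game needs is read in the polynomial ring through `e`:

* `Chart.img J = e (J(U))` — an ideal sheaf on `Y` read in the chart; `Chart.monIdeal A` — the
  monomial ideal of a set of game exponent vectors (`Chart.expOf α = α ∘ lab`).
* `Chart.point P` — the point of `U` given by a prime `P` of the polynomial ring;
  **`point_mem_support_iff`** (`∈ supp J ↔ img J ≤ P`),
  **`point_mem_markedSupport_iff`** (`∈ supp (J, k) ↔ (img J)·ℚ[x]_P ≤ 𝔪^k`, through the
  identification `𝒪_{Y, point P} ≅ ℚ[x]_P`), and **`isPrime_map_img_of_isRegular`** (a centre which is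
  a REGULAR scheme has prime stalk ideals, read in `ℚ[x]_P`).
* With file K7: `point (x_S)` is the generic point of the stratum cut out by `S` in the chart, and
  `point_coordIdeal_mem_markedSupport_iff` reads Kollár's `cosupp` there as «every member has
  `S`-degree `≥ k`».
-/

-- `Summit.<Summit>.<Sub>.Theorems` with `Sub = Summit` (single-conjunct summit, D-0017)
set_option linter.dupNamespace false

noncomputable section

open CategoryTheory AlgebraicGeometry TopologicalSpace IsLocalRing MvPolynomial
open Literature.AlgebraicGeometry.Resolution

namespace Summit.ResolutionOfSingularities.ResolutionOfSingularities.Theorems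

namespace PolyhedraGame

namespace RouteK

universe u

/-- [OURS · W5.2 M2-strong · Route K] A TORIC CHART of a level `Y` of the tower over `𝔸^{B₀}_ℚ`: an
affine open `U`, a ring isomorphism of its sections onto the polynomial ring `ℚ[x_b : b ∈ B₀]`, and a
labelling of the variables by game indices (`x_b` cuts out the boundary divisor `lab b` on `U`). -/
structure Chart (L : Finset ℕ) (Y : Scheme.{u}) where
  /-- the game index of each variable -/
  lab : ℕ → ℕ
  /-- the affine open -/
  U : Y.affineOpens
  /-- the coordinates -/
  e : Γ(Y, U) ≃+* MvPolynomial L ℚ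

namespace Chart

variable {L : Finset ℕ} {Y : Scheme.{u}} (c : Chart L Y)

/-- [OURS] The cone of the chart: the game indices of its variables. -/
def cone : Finset ℕ := L.image c.lab

/-- [OURS] An ideal sheaf read in the chart. -/
def img (J : Y.IdealSheafData) : Ideal (MvPolynomial L ℚ) :=
  (J.ideal c.U).map (c.e : Γ(Y, c.U) →+* MvPolynomial L ℚ)

/-- [OURS] Membership in the chart image. -/
theorem mem_img_iff (J : Y.IdealSheafData) (f : MvPolynomial L ℚ) :
    f ∈ c.img J ↔ c.e.symm f ∈ J.ideal c.U := by
  unfold img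
  rw [Ideal.map_comap_of_equiv, Ideal.mem_comap]

/-- [OURS] `img` is monotone. -/
theorem img_mono {J J' : Y.IdealSheafData} (h : J ≤ J') : c.img J ≤ c.img J' :=
  Ideal.map_mono (h c.U)

/-- [OURS] `img ⊤ = ⊤`. -/
@[simp] theorem img_top : c.img ⊤ = ⊤ := by
  rw [img, Scheme.IdealSheafData.ideal_top, Pi.top_apply, Ideal.map_top]

/-- [OURS] `img` of a product. -/
theorem img_mul (J J' : Y.IdealSheafData) : c.img (J * J') = c.img J * c.img J' := by
  rw [img, Scheme.IdealSheafData.ideal_mul, Pi.mul_apply, Ideal.map_mul]; rfl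

/-- [OURS] `img` of a power. -/
theorem img_pow (J : Y.IdealSheafData) (n : ℕ) : c.img (J ^ n) = c.img J ^ n := by
  induction n with
  | zero => rw [pow_zero, pow_zero, Scheme.IdealSheafData.one_eq_top, img_top, Ideal.one_eq_top]
  | succ n ih => rw [pow_succ, pow_succ, img_mul, ih]

/-- [OURS] `img` of a supremum. -/
theorem img_sup (J J' : Y.IdealSheafData) : c.img (J ⊔ J') = c.img J ⊔ c.img J' := by
  rw [img, Scheme.IdealSheafData.ideal_sup, Pi.sup_apply, Ideal.map_sup]; rfl

/-- [OURS] The chart exponent vector `α ∘ lab` of a game exponent vector. -/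
def expOf (α : ℕ →₀ ℕ) : L →₀ ℕ := Finsupp.equivFunOnFinite.symm fun b => α (c.lab b)

/-- [OURS] Unfolding. -/
@[simp] theorem expOf_apply (α : ℕ →₀ ℕ) (b : L) : c.expOf α b = α (c.lab b) := rfl

/-- [OURS] The monomial ideal of a set of game exponent vectors, read in the chart. -/
def monIdeal (A : Finset (ℕ →₀ ℕ)) : Ideal (MvPolynomial L ℚ) :=
  Ideal.span ((fun α => monomial (c.expOf α) (1 : ℚ)) '' (A : Set (ℕ →₀ ℕ)))

/-- [OURS] The monomial ideal as a span of monic monomials over the image exponent set. -/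
theorem monIdeal_eq (A : Finset (ℕ →₀ ℕ)) :
    c.monIdeal A = Ideal.span ((fun β => monomial β (1 : ℚ)) '' (c.expOf '' (A : Set (ℕ →₀ ℕ)))) := by
  rw [monIdeal, Set.image_image]

/-- [OURS] The `S`-degree of a chart exponent is the game weight on the labels of `S` (labelling
injective on `S`). -/
theorem sdeg_expOf (S : Finset L) (α : ℕ →₀ ℕ) (hinj : Set.InjOn c.lab (S.image Subtype.val : Set ℕ)) :
    sdeg S (c.expOf α) = weight ((S.image Subtype.val).image c.lab) α := by
  unfold sdeg weight
  rw [Finset.sum_image hinj, Finset.sum_image fun x _ y _ h => Subtype.val_injective h]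
  rfl

/-! ## Points of a chart -/

/-- [OURS] The prime of `Γ(Y, U)` corresponding to a prime of the polynomial ring. -/
def primeOf (P : Ideal (MvPolynomial L ℚ)) [P.IsPrime] : PrimeSpectrum Γ(Y, c.U) :=
  ⟨P.comap (c.e : Γ(Y, c.U) →+* MvPolynomial L ℚ), Ideal.IsPrime.comap _⟩

/-- [OURS] The point of the chart given by a prime of the polynomial ring. -/
def point (P : Ideal (MvPolynomial L ℚ)) [P.IsPrime] : Y := c.U.2.fromSpec (c.primeOf P)

/-- [OURS] The point lies in the chart. -/
theorem point_mem (P : Ideal (MvPolynomial L ℚ)) [P.IsPrime] : c.point P ∈ (c.U : Y.Opens) :=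
  c.U.2.range_fromSpec.le ⟨c.primeOf P, rfl⟩

/-- [OURS] **Support membership read in the chart**: the point of `P` lies in `supp J` iff
`img J ≤ P`. -/
theorem point_mem_support_iff (P : Ideal (MvPolynomial L ℚ)) [P.IsPrime] (J : Y.IdealSheafData) :
    c.point P ∈ J.support ↔ c.img J ≤ P := by
  rw [Scheme.IdealSheafData.mem_support_iff_of_mem (c.point_mem P), Scheme.mem_zeroLocus_iff]
  -- `point P ∈ X.basicOpen g ↔ g ∉ P.comap e`
  have key : ∀ g : Γ(Y, c.U), c.point P ∈ Y.basicOpen g ↔ c.e g ∉ P := by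
    intro g
    have h0 : c.point P ∈ Y.basicOpen g ↔ c.primeOf P ∈ c.U.2.fromSpec ⁻¹ᵁ Y.basicOpen g := Iff.rfl
    rw [h0, c.U.2.fromSpec_preimage_basicOpen g]
    exact Iff.rfl
  constructor
  · intro h f hf
    rw [mem_img_iff] at hf
    have h1 := h _ hf
    rw [key, not_not, RingEquiv.apply_symm_apply] at h1
    exact h1
  · intro h g hg
    rw [key, not_not]
    apply h
    rw [mem_img_iff, RingEquiv.symm_apply_apply]
    exact hg

/-! ## The local ring at a chart point is the localization of the polynomial ring -/

/-- [OURS] **`𝒪_{Y, point P} ≅ ℚ[x]_P` compatibly with ideal sheaves**: there is a ring isomorphism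
carrying the stalk of every ideal sheaf to the extension of its chart image and the maximal ideal to
the maximal ideal. -/
theorem exists_stalkEquiv (P : Ideal (MvPolynomial L ℚ)) [P.IsPrime] :
    ∃ Φ : Y.presheaf.stalk (c.point P) ≃+* Localization.AtPrime P,
      (∀ J : Y.IdealSheafData,
        (stalkIdeal J (c.point P)).map (Φ : Y.presheaf.stalk (c.point P) →+* Localization.AtPrime P) =
          (c.img J).map (algebraMap _ (Localization.AtPrime P))) ∧
        (maximalIdeal _).map (Φ : Y.presheaf.stalk (c.point P) →+* Localization.AtPrime P) =
          maximalIdeal (Localization.AtPrime P) := by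
  have hy := c.point_mem P
  -- `𝒪_{Y,y}` is the localization of `Γ(Y, U)` at the prime `P ∩ Γ(Y, U)`
  letI : Algebra Γ(Y, c.U) (Y.presheaf.stalk (c.point P)) :=
    Y.presheaf.algebra_section_stalk ⟨c.point P, hy⟩
  haveI hloc : IsLocalization.AtPrime (Y.presheaf.stalk (c.point P)) (c.primeOf P).asIdeal :=
    c.U.2.isLocalization_stalk' (c.primeOf P) hy
  have H : (c.primeOf P).asIdeal.primeCompl.map (c.e : Γ(Y, c.U) ≃+* MvPolynomial L ℚ).toMonoidHom =
      P.primeCompl := by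
    ext f
    simp only [Submonoid.mem_map]
    constructor
    · rintro ⟨g, hg, rfl⟩
      exact hg
    · intro hf
      exact ⟨c.e.symm f, by
        change c.e.symm f ∉ P.comap (c.e : Γ(Y, c.U) →+* MvPolynomial L ℚ)
        rw [Ideal.mem_comap]
        change ¬ (c.e (c.e.symm f) ∈ P)
        rw [RingEquiv.apply_symm_apply]; exact hf, c.e.apply_symm_apply f⟩
  let Φ : Y.presheaf.stalk (c.point P) ≃+* Localization.AtPrime P :=
    IsLocalization.ringEquivOfRingEquiv (M := (c.primeOf P).asIdeal.primeCompl) (T := P.primeCompl)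
      (Y.presheaf.stalk (c.point P)) (Localization.AtPrime P) c.e H
  have hΦ : ∀ a : Γ(Y, c.U), Φ (algebraMap _ _ a) = algebraMap _ (Localization.AtPrime P) (c.e a) :=
    fun a => IsLocalization.ringEquivOfRingEquiv_eq H a
  have hcomp : (Φ : Y.presheaf.stalk (c.point P) →+* Localization.AtPrime P).comp
        (algebraMap Γ(Y, c.U) (Y.presheaf.stalk (c.point P))) =
      (algebraMap (MvPolynomial L ℚ) (Localization.AtPrime P)).comp (c.e : Γ(Y, c.U) →+* MvPolynomial L ℚ) :=
    RingHom.ext hΦ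
  refine ⟨Φ, fun J => ?_, ?_⟩
  · rw [stalkIdeal_eq_map_germ J c.U hy, show (Y.presheaf.germ c.U (c.point P) hy).hom =
        algebraMap Γ(Y, c.U) (Y.presheaf.stalk (c.point P)) from rfl, Ideal.map_map, hcomp,
      ← Ideal.map_map]
    rfl
  · rw [← IsLocalization.AtPrime.map_eq_maximalIdeal (c.primeOf P).asIdeal (Y.presheaf.stalk (c.point P)),
      Ideal.map_map, hcomp, ← Ideal.map_map, ← Localization.AtPrime.map_eq_maximalIdeal]
    congr 1
    change (P.comap (c.e : Γ(Y, c.U) →+* MvPolynomial L ℚ)).map (c.e : Γ(Y, c.U) →+* MvPolynomial L ℚ) = P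
    exact Ideal.map_comap_of_surjective _ c.e.surjective P

/-- [OURS] **Marked support read in the chart**: the point of `P` lies in `supp (J, k)` iff the
extension of `img J` to `ℚ[x]_P` lies in `𝔪^k`. -/
theorem point_mem_markedSupport_iff (P : Ideal (MvPolynomial L ℚ)) [P.IsPrime] (J : Y.IdealSheafData)
    (E : List Y.IdealSheafData) (k : ℕ) :
    c.point P ∈ (⟨J, E, k⟩ : MarkedIdeal Y).support ↔
      (c.img J).map (algebraMap _ (Localization.AtPrime P)) ≤ maximalIdeal (Localization.AtPrime P) ^ k := by
  obtain ⟨Φ, hΦ, hmax⟩ := c.exists_stalkEquiv P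
  rw [MarkedIdeal.mem_support_iff]
  change stalkIdeal J (c.point P) ≤ maximalIdeal _ ^ k ↔ _
  rw [← hΦ J, ← hmax, ← Ideal.map_pow]
  constructor
  · exact fun h => Ideal.map_mono h
  · intro h
    have := Ideal.map_mono (f := (Φ.symm : Localization.AtPrime P →+* Y.presheaf.stalk (c.point P))) h
    rwa [Ideal.map_of_equiv, Ideal.map_of_equiv] at this

/-- [OURS] **Regular centres have prime stalks, read in the chart**: if `V(C)` is a regular scheme and
the point of `P` lies on it (`img C ≤ P`), then the extension of `img C` to `ℚ[x]_P` is prime. -/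
theorem isPrime_map_img_of_isRegular [IsLocallyNoetherian Y] (P : Ideal (MvPolynomial L ℚ)) [P.IsPrime]
    {C : Y.IdealSheafData} (hC : Scheme.IsRegular C.subscheme) (hP : c.img C ≤ P) :
    ((c.img C).map (algebraMap _ (Localization.AtPrime P))).IsPrime := by
  obtain ⟨Φ, hΦ, -⟩ := c.exists_stalkEquiv P
  have hy : c.point P ∈ C.support := (c.point_mem_support_iff P C).mpr hP
  haveI hreg := (Scheme.isRegular_subscheme_iff C).mp hC _ hy
  haveI : (stalkIdeal C (c.point P)).IsPrime :=
    (Ideal.Quotient.isDomain_iff_prime _).mp (isDomain_of_isRegularLocalRing _)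
  rw [← hΦ C]
  exact Ideal.map_isPrime_of_equiv _

/-! ## Reading orders at the generic point of a stratum -/

/-- [OURS] **Kollár's cosupport at the generic point of a coordinate stratum**: for `S ⊆ B₀`, the
point of the chart at the prime `(x_S)` lies in `supp (monIdeal A, k)` iff every member has `S`-degree
`≥ k`. -/
theorem point_coordIdeal_mem_markedSupport_iff [DecidableEq L] (S : Finset L) (A : Finset (ℕ →₀ ℕ))
    (J : Y.IdealSheafData) (hJ : c.img J = c.monIdeal A) (E : List Y.IdealSheafData) (k : ℕ) :
    (haveI := coordIdeal_isPrime (K := ℚ) S; c.point (coordIdeal S)) ∈ (⟨J, E, k⟩ : MarkedIdeal Y).support ↔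
      ∀ α ∈ A, k ≤ sdeg S (c.expOf α) := by
  haveI := coordIdeal_isPrime (K := ℚ) S
  rw [c.point_mem_markedSupport_iff, hJ, monIdeal_eq,
    map_span_monomial_le_pow_iff S _ (Localization.AtPrime (coordIdeal (K := ℚ) S)) k]
  simp only [Set.mem_image, Finset.mem_coe, forall_exists_index, and_imp, forall_apply_eq_imp_iff₂]

/-! ## Torus-stable regular centres read as one coordinate stratum -/

/-- [OURS] A single-coordinate scaling is a torus scaling (file K3(a)'s `scaleHom`). -/
theorem scaleHom_update [DecidableEq L] (i : L) (q : ℚ) :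
    scaleHom (Function.update (fun _ : L => (1 : ℚ)) i q) =
      aeval (Function.update MvPolynomial.X i (MvPolynomial.C q * MvPolynomial.X i) : L → MvPolynomial L ℚ) := by
  apply MvPolynomial.algHom_ext
  intro b
  rw [scaleHom_X, aeval_X]
  by_cases hb : b = i
  · subst hb; simp
  · simp [Function.update_of_ne hb]

/-- [OURS · Route K, K8] **A centre which is a regular scheme and whose chart image is stable under
all torus scalings is, in the chart, ONE coordinate stratum** `(x_i : i ∈ S)` (or empty): file K7's
`eq_coordIdeal_of_scaling_stable_of_isPrime` at the origin of the chart, primality coming from the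
regularity of `V(C)` at that point (`isPrime_map_img_of_isRegular`). -/
theorem exists_img_eq_coordIdeal [IsLocallyNoetherian Y] [DecidableEq L] {C : Y.IdealSheafData}
    (hC : Scheme.IsRegular C.subscheme)
    (hstab : ∀ t : L → ℚ, (∀ b, t b ≠ 0) → ∀ f ∈ c.img C, scaleHom t f ∈ c.img C)
    (hne : c.img C ≠ ⊤) :
    ∃ S : Finset L, c.img C = coordIdeal S ∧ ∀ i, i ∈ S ↔ (MvPolynomial.X i : MvPolynomial L ℚ) ∈ c.img C := by
  have hI : ∀ (i : L) (q : ℚ), q ≠ 0 → ∀ f ∈ c.img C,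
      aeval (Function.update MvPolynomial.X i (MvPolynomial.C q * MvPolynomial.X i)) f ∈ c.img C := by
    intro i q hq f hf
    rw [← scaleHom_update]
    refine hstab _ (fun b => ?_) f hf
    by_cases hb : b = i
    · subst hb; simpa using hq
    · simp [Function.update_of_ne hb]
  haveI : (idealOfVars L ℚ).IsPrime := idealOfVars_isPrime
  have hle : c.img C ≤ idealOfVars L ℚ := le_idealOfVars_of_scaling_stable hI hne
  have hprime := c.isPrime_map_img_of_isRegular (idealOfVars L ℚ) hC hle
  exact eq_coordIdeal_of_scaling_stable_of_isPrime (Rₘ := Localization.AtPrime (idealOfVars L ℚ)) hI hne hprime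

end Chart

end RouteK

end PolyhedraGame

end Summit.ResolutionOfSingularities.ResolutionOfSingularities.Theorems

end
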